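import Literature.Analysis.FluidPDE.FluidComputer.TubeTable
import HarnessLib

/-!
# Kernel run of the tube checker, chunks 0 … 5 (steps 0 … 299) (bp3 gen 13)

HONEST FRAMING: low prior, high value-of-information experiment on Tao's machine paradigm; NOT a
claim that NS blows up.

Kernel evaluations (`decide +kernel`; no `native_decide`, no extra axioms) of the tube checker
`runTube` of `TubeCheck.lean` (dyadic interval arithmetic `DI` at `P = 60`, `12` Taylor terms,
cube radius `Rt`, read-out level `CLt`) on the chunks `cT 0 … cT 5` of the schedule of
`TubeTable.lean`, each from the recorded boundary state `sT i` to `sT (i+1)` (≈ 0.6 s of kernel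
time per step).
-/

namespace Literature.Analysis.FluidPDE.FluidComputer

namespace TubeTable

open ThresholdLevelTable

set_option maxHeartbeats 10000000 in
set_option maxRecDepth 200000 in
/-- Chunk 0 of the tube run (steps 0 … 49, `h = 2^-11`). [folklore] -/
theorem run_0 : runTube 60 12 GIt CLt Rt (sT 0) (cT 0) = some (sT (0 + 1)) := by
  decide +kernel

set_option maxHeartbeats 10000000 in
set_option maxRecDepth 200000 in
/-- Chunk 1 of the tube run (steps 50 … 99, `h = 2^-11`). [folklore] -/
theorem run_1 : runTube 60 12 GIt CLt Rt (sT 1) (cT 1) = some (sT (1 + 1)) := by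
  decide +kernel

set_option maxHeartbeats 10000000 in
set_option maxRecDepth 200000 in
/-- Chunk 2 of the tube run (steps 100 … 149, `h = 2^-11`). [folklore] -/
theorem run_2 : runTube 60 12 GIt CLt Rt (sT 2) (cT 2) = some (sT (2 + 1)) := by
  decide +kernel

set_option maxHeartbeats 10000000 in
set_option maxRecDepth 200000 in
/-- Chunk 3 of the tube run (steps 150 … 199, `h = 2^-11`). [folklore] -/
theorem run_3 : runTube 60 12 GIt CLt Rt (sT 3) (cT 3) = some (sT (3 + 1)) := by
  decide +kernel

set_option maxHeartbeats 10000000 in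
set_option maxRecDepth 200000 in
/-- Chunk 4 of the tube run (steps 200 … 249, `h = 2^-11`). [folklore] -/
theorem run_4 : runTube 60 12 GIt CLt Rt (sT 4) (cT 4) = some (sT (4 + 1)) := by
  decide +kernel

set_option maxHeartbeats 10000000 in
set_option maxRecDepth 200000 in
/-- Chunk 5 of the tube run (steps 250 … 299, `h = 2^-11`). [folklore] -/
theorem run_5 : runTube 60 12 GIt CLt Rt (sT 5) (cT 5) = some (sT (5 + 1)) := by
  decide +kernel

end TubeTable

end Literature.Analysis.FluidPDE.FluidComputer
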